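import Mathlib
import Summits.MatrixMultiplication.MatrixMultiplication.Theorems.HiddenToeplitzCornersHiddenCornerLemmaRCapacityBasic
import Summits.MatrixMultiplication.MatrixMultiplication.Theorems.HiddenToeplitzCornersHiddenCornerLemmaRCapacityKrylov
import Summits.MatrixMultiplication.MatrixMultiplication.Theorems.HiddenToeplitzCornersHiddenCornerLemmaRCapacityAct
import Summits.MatrixMultiplication.MatrixMultiplication.Theorems.HiddenToeplitzCornersHiddenCornerLemmaRCapacityDict

/-!
# Strip theorem, package G, step G1: block orthogonality from the annihilator hypothesis

Support file for crux item `stmt-MatrixMultiplication-10752`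
(`Summit.MatrixMultiplication.MatrixMultiplication.Theses.HiddenToeplitzCorners.HiddenCornerLemmaR`)
of line `frobenius-dual-short-syzygies`, stub `stub_gconstDualLaw` / the strip theorem with STRIP
generators `G₀ i k = [i = c k]` (paper proof `math/STRIP_THEOREM.md` §3, step (G1)).

Setting (everything is written out, no notation).  `Z` is the lower shift on `Fin N → ℂ`
(`Z i j = [i = j + 1]`), `Zᵀ` the up-shift; `toPoly v = Σ_{i<N} v i • X^i` is written through
`Polynomial.degreeLTEquiv`; `δ := Polynomial.divX`; a coefficient polynomial `f` acts on `g ∈ ℂ[X]`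
by `act f g := Σ_i coeff f i • δ^[i] g` (`Polynomial.lsum`); the polynomial frame of
`E : Matrix (Fin N) (Fin r) ℂ` is `c' ↦ toPoly (column c' of E)`, its evaluation map is
`Ev α = Σ_{c'} act (α c') (toPoly (E · c'))`, and the relations at window `w` are
`Rel_w = ker Ev ⊓ (coefficient-degree < w)`.

The annihilator hypothesis `hann` of `stub_gconstDualLaw` says: every `Λ : Matrix (Fin N) (Fin r) ℂ`
with `Σ_{c'} U(W_k Λᵀ c') (Eᵀ c') = 0` for all generators `k`, where `U(μ) := Σ_j μ j • (Zᵀ)^j` and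
`W_k := Σ_i G₀ i k • (Zᵀ)^i` (`= (Zᵀ)^(c k)` for strip generators, `0` if `c k ≥ N`), satisfies
`Λᵀ * F = 0`.

Result `hclR_strip_block_orth` (G1): for a strip `[c k, c k + wk)` containing no other generator row
(`hgap`), every relation `α ∈ Rel_wk` of the polynomial frame and all slots `b, a` give
`Σ_{m<wk} coeff (α b) m * F (c k + m) a = 0`.

Proof.  Put `Λ n c' := coeff (α c') (n - c k)` for `n ≥ c k` (and `0` below); since
`α c' ∈ degreeLT wk` and `c k + wk ≤ N`, `toPoly (Λᵀ c') = X^(c k) * α c'`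
(`hclR_stripG_toPoly_strip`).  By the dictionary (`hclR_toPoly_corr_mulVec`, toolkit E) the
`c'`-term of the premise of `hann` for generator `k'` has `toPoly` equal to
`act (act (toPoly (G₀ · k')) (X^(c k) * α c')) (toPoly (Eᵀ c'))` with `toPoly (G₀ · k') = X^(c k')`
(or `0` if `c k' ≥ N`), and `act (X^(c k')) (X^(c k) * α c') = δ^[c k'] (X^(c k) * α c')` is
`X^(c k - c k') * α c'` if `c k' ≤ c k`, and `0` if `c k < c k'` (then `c k + wk ≤ c k'` by `hgap`
and `X^(c k) * α c' ∈ degreeLT (c k + wk)`).  In the first case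
`Σ_{c'} act (X^s * α c') (toPoly (Eᵀ c')) = δ^[s] (Ev α) = 0`.  So `toPoly` of the premise vanishes,
the premise holds (`toPoly` is injective), `Λᵀ * F = 0`, and its `(b, a)` entry is the claimed sum.
Folklore linear algebra; Mathlib and the landed toolkit modules (Stein, CapacityBasic,
CapacityKrylov, CapacityAct, CapacityDict) only.
-/

set_option linter.dupNamespace false

namespace Summit.MatrixMultiplication.MatrixMultiplication.Theorems

open Polynomial
open scoped Matrix

/-! ## Helpers -/

/-- `δ^[n] (X ^ n * f) = f`. -/
theorem hclR_stripG_divX_iterate_X_pow_mul (n : ℕ) (f : ℂ[X]) :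
    Polynomial.divX^[n] ((X : ℂ[X]) ^ n * f) = f := by
  ext i
  rw [hclR_capD_coeff_divX_iterate, Polynomial.coeff_X_pow_mul]

/-- `p ∈ degreeLT w → X ^ n * p ∈ degreeLT (n + w)`. -/
theorem hclR_stripG_X_pow_mul_mem_degreeLT {w : ℕ} {p : ℂ[X]}
    (hp : p ∈ Polynomial.degreeLT ℂ w) (n : ℕ) :
    (X : ℂ[X]) ^ n * p ∈ Polynomial.degreeLT ℂ (n + w) := by
  rw [Polynomial.mem_degreeLT, Polynomial.degree_lt_iff_coeff_zero] at hp ⊢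
  intro m hm
  rw [Polynomial.coeff_X_pow_mul']
  split_ifs with h
  · exact hp _ (by omega)
  · rfl

/-- `δ^[s]` commutes with finite sums. -/
theorem hclR_stripG_divX_iterate_sum {ι : Type*} (S : Finset ι) (g : ι → ℂ[X]) (s : ℕ) :
    Polynomial.divX^[s] (∑ i ∈ S, g i) = ∑ i ∈ S, Polynomial.divX^[s] (g i) := by
  have h0 : Polynomial.divX^[s] (0 : ℂ[X]) = 0 :=
    (hclR_divX_iterate_eq_zero_iff 0 s).2 (Submodule.zero_mem _)
  exact map_sum (⟨⟨fun q => Polynomial.divX^[s] q, h0⟩,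
    fun q q' => hclR_capD_divX_iterate_add q q' s⟩ : ℂ[X] →+ ℂ[X]) g S

/-- `toPoly` of the generator column `k` of `G₀ = ([i = c k])`: the monomial `X ^ (c k)` if
`c k < N`, and `0` otherwise. -/
theorem hclR_stripG_toPoly_gen {N p : ℕ} (c : Fin p → ℕ) (k : Fin p) :
    (((Polynomial.degreeLT ℂ (N)).subtype ∘ₗ (Polynomial.degreeLTEquiv ℂ (N)).symm.toLinearMap :
        (Fin (N) → ℂ) →ₗ[ℂ] Polynomial ℂ)) (fun i => (Matrix.of fun (i : Fin N) (k : Fin p) => if (i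
        : ℕ) = c k then (1 : ℂ) else 0) i k) = if c k < N then (X : ℂ[X]) ^ (c k) else 0 := by
  ext j
  rw [hclR_coeff_toPoly]
  by_cases hj : j < N
  · rw [dif_pos hj, Matrix.of_apply]
    by_cases hk : c k < N
    · rw [if_pos hk, Polynomial.coeff_X_pow]
    · rw [if_neg hk, Polynomial.coeff_zero, if_neg]
      exact fun h => hk (by omega)
  · rw [dif_neg hj]
    by_cases hk : c k < N
    · rw [if_pos hk, Polynomial.coeff_X_pow, if_neg (by omega)]
    · rw [if_neg hk, Polynomial.coeff_zero]

/-- `toPoly` of column `c'` of the test matrix `Λ n c' := coeff (α c') (n - c k)` (`n ≥ c k`):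
it is `X ^ (c k) * α c'`, because `α c' ∈ degreeLT wk` and `c k + wk ≤ N`. -/
theorem hclR_stripG_toPoly_strip {N r p : ℕ} (c : Fin p → ℕ) (k : Fin p) (wk : ℕ)
    (hwk : c k + wk ≤ N) (α : Fin r → ℂ[X]) (hdeg : ∀ c', α c' ∈ Polynomial.degreeLT ℂ wk)
    (c' : Fin r) :
    (((Polynomial.degreeLT ℂ (N)).subtype ∘ₗ (Polynomial.degreeLTEquiv ℂ (N)).symm.toLinearMap :
        (Fin (N) → ℂ) →ₗ[ℂ] Polynomial ℂ)) ((Matrix.of fun (n : Fin N) (c' : Fin r) => if c k ≤ (n :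
        ℕ) then (α c').coeff ((n : ℕ) - c k) else 0)ᵀ c') = (X : ℂ[X]) ^ (c k) * α c' := by
  have hβ := hdeg c'
  rw [Polynomial.mem_degreeLT, Polynomial.degree_lt_iff_coeff_zero] at hβ
  ext j
  rw [hclR_coeff_toPoly, Polynomial.coeff_X_pow_mul']
  by_cases hj : j < N
  · rw [dif_pos hj, Matrix.transpose_apply, Matrix.of_apply]
  · rw [dif_neg hj]
    split_ifs with h
    · exact (hβ _ (by omega)).symm
    · rfl

/-- Reindexing the strip: `Σ_{m<w} coeff β m * F (c0 + m) a = Σ_n Λ_β n * F n a` with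
`Λ_β n = coeff β (n - c0)` for `n ≥ c0` and `0` below (`β ∈ degreeLT w`, `c0 + w ≤ N`). -/
theorem hclR_stripG_sum_strip {N r : ℕ} (c0 w : ℕ) (hw : c0 + w ≤ N) (β : ℂ[X])
    (hβ : β ∈ Polynomial.degreeLT ℂ w) (F : Matrix (Fin N) (Fin r) ℂ) (a : Fin r) :
    ∑ m : Fin w, β.coeff m * F ⟨c0 + m, by omega⟩ a =
      ∑ n : Fin N, (if c0 ≤ (n : ℕ) then β.coeff ((n : ℕ) - c0) else 0) * F n a := by
  rw [Polynomial.mem_degreeLT, Polynomial.degree_lt_iff_coeff_zero] at hβ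
  refine Fintype.sum_of_injective (fun m : Fin w => (⟨c0 + (m : ℕ), by omega⟩ : Fin N))
    (fun m m' h => Fin.ext (by have := Fin.mk.inj h; omega)) _ _ (fun n hn => ?_) (fun m => ?_)
  · by_cases h : c0 ≤ (n : ℕ)
    · have h' : w ≤ (n : ℕ) - c0 := by
        by_contra hlt
        exact hn ⟨⟨(n : ℕ) - c0, by omega⟩, Fin.ext (show c0 + ((n : ℕ) - c0) = (n : ℕ) by omega)⟩
      rw [if_pos h, hβ _ h', zero_mul]
    · rw [if_neg h, zero_mul]
  · simp

/-- The premise of the annihilator hypothesis for the test matrix `Λ` and a generator `k'`: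
`Σ_{c'} U(W_{k'} Λᵀ c') (Eᵀ c') = 0`.  Apply the injective `toPoly` and the dictionary twice; the
`c'`-term becomes `act (act (toPoly (G₀ · k')) (X^(c k) * α c')) (toPoly (Eᵀ c'))`, which is
`δ^[c k - c k'] (act (α c') (toPoly (Eᵀ c')))` if `c k' ≤ c k` (`c k' < N`) and `0` otherwise;
the sum of the former is `δ^[s] (Ev α) = 0`. -/
theorem hclR_stripG_premise (r N p : ℕ) (c : Fin p → ℕ) (E : Matrix (Fin N) (Fin r) ℂ)
    (k : Fin p) (wk : ℕ) (hwk : c k + wk ≤ N)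
    (hgap : ∀ k' : Fin p, c k < c k' → c k + wk ≤ c k') (α : Fin r → ℂ[X])
    (hdeg : ∀ c', α c' ∈ Polynomial.degreeLT ℂ wk)
    (hker : ∑ c' : Fin r, ((Polynomial.lsum (fun (i : ℕ) => LinearMap.smulRight (LinearMap.id : ℂ
        →ₗ[ℂ] ℂ) (Polynomial.divX^[i] ((((Polynomial.degreeLT ℂ (N)).subtype ∘ₗ
        (Polynomial.degreeLTEquiv ℂ (N)).symm.toLinearMap : (Fin (N) → ℂ) →ₗ[ℂ] Polynomial ℂ)) (Eᵀ
        c') : Polynomial ℂ))) : Polynomial ℂ →ₗ[ℂ] Polynomial ℂ)) (α c') = 0) (k' : Fin p) :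
    (∑ c' : Fin r, (∑ j : Fin N, (((∑ i : Fin N, (Matrix.of fun (i : Fin N) (k : Fin p) => if (i :
        ℕ) = c k then (1 : ℂ) else 0) i k' • ((Matrix.transpose (Matrix.of fun i j : Fin (N) => if
        (i : ℕ) = (j : ℕ) + 1 then (1 : ℂ) else 0))) ^ (i : ℕ)) *ᵥ
      ((Matrix.of fun (n : Fin N) (c' : Fin r) => if c k ≤ (n : ℕ) then (α c').coeff ((n : ℕ) - c k)
          else 0)ᵀ c')) j) • ((Matrix.transpose (Matrix.of fun i j : Fin (N) => if (i : ℕ) = (j : ℕ)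
          + 1 then (1 : ℂ) else 0))) ^ (j : ℕ)) *ᵥ (Eᵀ c')) = 0 := by
  refine hclR_toPoly_injective ?_
  rw [map_zero, map_sum]
  simp only [hclR_toPoly_corr_mulVec, hclR_stripG_toPoly_gen,
    hclR_stripG_toPoly_strip c k wk hwk α hdeg]
  by_cases hkN : c k' < N
  · rw [if_pos hkN]
    simp only [hclR_act_X_pow]
    by_cases hle : c k' ≤ c k
    · rw [show (X : ℂ[X]) ^ c k = X ^ c k' * X ^ (c k - c k') by
        rw [← pow_add, Nat.add_sub_cancel' hle]]
      simp only [mul_assoc, hclR_stripG_divX_iterate_X_pow_mul, hclR_capD_act_X_pow_mul]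
      rw [← hclR_stripG_divX_iterate_sum, hker]
      exact (hclR_divX_iterate_eq_zero_iff 0 _).2 (Submodule.zero_mem _)
    · have hz : ∀ c' : Fin r, Polynomial.divX^[c k'] ((X : ℂ[X]) ^ c k * α c') = 0 := fun c' =>
        (hclR_divX_iterate_eq_zero_iff _ _).2 (Polynomial.degreeLT_mono (hgap k' (not_le.1 hle))
          (hclR_stripG_X_pow_mul_mem_degreeLT (hdeg c') (c k)))
      simp only [hz, map_zero, Finset.sum_const_zero]
  · rw [if_neg hkN]
    simp only [map_zero, Finset.sum_const_zero]

/-! ## G1 — block orthogonality -/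

-- The registered signature is a closed `∀`-statement whose named hypothesis binders (`hann`, `hgap`,
-- `hα`) are not referenced by the conclusion's type; silence the unused-variables linter on it.
set_option linter.unusedVariables false in
/-- **G1** (block orthogonality).  Under the annihilator hypothesis of `stub_gconstDualLaw` with
STRIP generators (`G₀ i k = [i = c k]`), for a strip `[c k, c k + wk)` containing no other
generator row (`hgap`), every relation `α` of the polynomial frame `c' ↦ toPoly (E · c')` at window
`wk` and every pair of slots `b, a` satisfy `Σ_{m<wk} coeff (α b) m * F (c k + m) a = 0`: the
coefficient vector of `α b`, placed on the strip, is orthogonal to column `a` of `F`.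
Proof: the test matrix `Λ n c' := coeff (α c') (n - c k)` (`n ≥ c k`) satisfies the premise of
`hann` (`hclR_stripG_premise`), so `Λᵀ * F = 0`, whose `(b, a)` entry is the claimed sum
(`hclR_stripG_sum_strip`). -/
theorem hclR_strip_block_orth :
    ∀ (r N p : ℕ) (c : Fin p → ℕ) (E F : Matrix (Fin N) (Fin r) ℂ) (hann : ∀ Λ : Matrix (Fin N)
    (Fin r) ℂ, (∀ k : Fin p, (∑ c' : Fin r, (∑ j : Fin N, (((∑ i : Fin N, (Matrix.of fun (i : Fin
    N) (k : Fin p) => if (i : ℕ) = c k then (1 : ℂ) else 0) i k • (((Matrix.transpose (Matrix.of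
    fun i j : Fin (N) => if (i : ℕ) = (j : ℕ) + 1 then (1 : ℂ) else 0)))) ^ (i : ℕ)) *ᵥ (Λᵀ c'))
    j) • (((Matrix.transpose (Matrix.of fun i j : Fin (N) => if (i : ℕ) = (j : ℕ) + 1 then (1 : ℂ)
    else 0)))) ^ (j : ℕ)) *ᵥ (Eᵀ c')) = 0) → Λᵀ * F = 0) (k : Fin p) (wk : ℕ) (hwk : c k + wk ≤ N)
    (hgap : ∀ k' : Fin p, c k < c k' → c k + wk ≤ c k') (α : Fin r → (Polynomial ℂ)) (hα : α ∈
    (LinearMap.ker (∑ c : Fin r, LinearMap.comp (Polynomial.lsum (fun (i : ℕ) =>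
    LinearMap.smulRight (LinearMap.id : ℂ →ₗ[ℂ] ℂ) (Polynomial.divX^[i] ((fun c' =>
    (((Polynomial.degreeLT ℂ (N)).subtype ∘ₗ (Polynomial.degreeLTEquiv ℂ (N)).symm.toLinearMap :
    (Fin (N) → ℂ) →ₗ[ℂ] Polynomial ℂ)) (fun n => (E : Matrix (Fin N) (Fin _) ℂ) n c')) c :
    Polynomial ℂ))) : Polynomial ℂ →ₗ[ℂ] Polynomial ℂ) (LinearMap.proj c : (Fin r → Polynomial ℂ)
    →ₗ[ℂ] Polynomial ℂ)) ⊓ (Submodule.pi Set.univ (fun _ : Fin r => Polynomial.degreeLT ℂ (wk)) :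
    Submodule ℂ (Fin r → Polynomial ℂ)))) (b a : Fin r), ∑ m : Fin wk, (α b).coeff m * F ⟨c k + m,
    by omega⟩ a = 0 := by
  intro r N p c E F hann k wk hwk hgap α hα b a
  obtain ⟨hker, hdeg⟩ := Submodule.mem_inf.1 hα
  rw [LinearMap.mem_ker, hclR_capA_EvL_apply] at hker
  have hdeg' : ∀ c', α c' ∈ Polynomial.degreeLT ℂ wk := fun c' => hdeg c' (Set.mem_univ c')
  have hmain := hann (Matrix.of fun (n : Fin N) (c' : Fin r) => if c k ≤ (n : ℕ) then (α c').coeff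
      ((n : ℕ) - c k) else 0)
    (hclR_stripG_premise r N p c E k wk hwk hgap α hdeg' hker)
  have h := congr_fun (congr_fun hmain b) a
  rw [Matrix.mul_apply, Matrix.zero_apply] at h
  simp only [Matrix.transpose_apply, Matrix.of_apply] at h
  rw [hclR_stripG_sum_strip (c k) wk hwk (α b) (hdeg' b) F a]
  exact h

end Summit.MatrixMultiplication.MatrixMultiplication.Theorems
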